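import Summits.CriticalPhenomena.SAWScalingLimit.Theorems.SAWDevelopingMapInteriorFlatteningLiouvilleDefs
import Summits.CriticalPhenomena.SAWScalingLimit.Theorems.SAWDevelopingMapInteriorFlatteningSpinDictionary
import Summits.CriticalPhenomena.SAWScalingLimit.Theses.SAWDevelopingMap

/-!
# S1 `BulkNoFold` of the line `liouville-local-limits` (crux `InteriorFlattening`, stmt-CriticalPhenomena-8297): reductions

Lead prover `prover-line-stmt-CriticalPhenomena-8297-c1-0`, line `liouville-local-limits`, stub S1
`stub_bulkNoFold` — EVENTUAL BULK NO-FOLD ((K)-lite):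

  `∃ k R₀ : ℝ, 0 ≤ k ∧ k < 1 ∧ RatioAtDepth R₀ k`,

i.e. SOME `k < 1` bounds the Beltrami quotient `‖F₀ + ωF₁ + ω²F₂‖ / ‖F₀ + F₁ + F₂‖` of the DCS
observable `F = F(a, ·, x_c, 5/8)` at every `R₀`-deep vertex of every simply connected hexagonal domain
with a boundary root, in every frame (the input of the lattice Harnack inequality behind S2, S5, S7).
HONEST STATUS: open — a bound `k < 1` on the first-arrival superposition of slit source triples at a
deep vertex is the (slit-)coherence content of the rank-2 crux `NoFoldBound` (stmt-CriticalPhenomena-8296).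
This file records, over the objects of the Defs module `…SAWDevelopingMapInteriorFlatteningLiouvilleDefs`,
the cheap and durable facts that place S1 in the route and that the S2/S7 workers consume:

* `bulkNoFold_of_noFoldBound` (registered sub-goal) — S1 is implied by (K) = `…SAWDevelopingMap.NoFoldBound`
  (`k ↦ max k 0`, `R₀ = 0`);
* `bulkNoFold_of_interiorFlattening` — S1 is implied by the crux (M) itself (`ε = 1/2`), via the
  read-back `interiorFlattening_iff_ratioAtDepth` (`Iff.rfl`);
* `ratioAtDepth_mono` — `RatioAtDepth R η` is monotone in `(R, η)` (`Deep` is antitone in the radius),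
  and `bulkNoFold_iff_nat` — the depth may be taken in `ℕ`; `ratioAtDepth_iff_depthFlat` —
  `RatioAtDepth` IS the one-mouth line's `OneMouth.DepthFlat`, so S1 gives that line's S6
  (`deepBoundedDistortion_of_bulkNoFold`);
* `ratioAtDepth_iff_cw` — for `η ≥ 0` it suffices to check CLOCKWISE frames: the counter-clockwise
  `ω`-combination of the observable vanishes identically (DCS Lemma 1 in mode form,
  `OneMouth.bel_eq_zero_of_ccw`, and the two orientation classes of a labelled star, `hexStar_directions`);
* the frame algebra of an arbitrary lattice field (`three_mul_apply_eq`: `3 G₀ = M + B + B'`, inverse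
  `ℤ/3` Fourier transform with the transposed frame) and its consequences under `RatioAtDepth R k`:
  `three_mul_norm_obs_le` (`3 ‖F{v,w₀}‖ ≤ (1 + 2k) ‖M‖`, no Lemma 1 needed),
  `three_mul_norm_obs_le_sc` (`3 ‖F{v,w₀}‖ ≤ (1 + k) ‖M‖`, with Lemma 1),
  `obs_star_eq_zero_of_fieldMono_eq_zero` / `fieldMono_ne_zero_of_obs_ne_zero` — at an `R`-deep vertex the
  monopole vanishes only if all three edge values do (non-degeneracy of the normalisation `M(O)`).

Sources: H. Duminil-Copin, S. Smirnov, Ann. of Math. 175 (2012) 1653–1665 (arXiv:1007.0575), Lemma 1; the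
line card `Cruxes/InteriorFlattening/Lines/liouville-local-limits.md`. (K), (M) enter only as hypotheses.
-/

noncomputable section

open scoped BigOperators
open Literature.Probability.LatticeModels Literature.Probability.RandomPlanarGeometry.SAW

namespace Summit.CriticalPhenomena.SAWScalingLimit.Theorems.InteriorFlattening.Liouville

namespace BulkNoFold

/-! ### Read-back and the two implications placing S1 in the route -/

/-- READ-BACK: the crux (M) is `∀ ε > 0, ∃ R, RatioAtDepth R ε`, definitionally (`obs`, `omega`,
`fieldBelt`, `fieldMono`, `Deep` of the Defs module are literally the crux's `F`, `ω`, two sides and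
ball hypothesis). -/
theorem interiorFlattening_iff_ratioAtDepth :
    Summit.CriticalPhenomena.SAWScalingLimit.Theses.SAWDevelopingMap.InteriorFlattening ↔
      ∀ ε : ℝ, 0 < ε → ∃ R : ℝ, RatioAtDepth R ε :=
  Iff.rfl

/-- **S1 is implied by (K)** (registered sub-goal of the crux). The route's rank-2 crux `NoFoldBound`
(stmt-CriticalPhenomena-8296: one contraction factor `k < 1` at EVERY vertex of every simply connected
domain with a boundary root) gives eventual bulk no-fold with `k ↦ max k 0` and `R₀ = 0`; the depth
hypothesis is not even used. -/
theorem bulkNoFold_of_noFoldBound :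
    Summit.CriticalPhenomena.SAWScalingLimit.Theses.SAWDevelopingMap.NoFoldBound →
      ∃ k R₀ : ℝ, 0 ≤ k ∧ k < 1 ∧ RatioAtDepth R₀ k := by
  rintro ⟨k, hk1, hK⟩
  refine ⟨max k 0, 0, le_max_right _ _, max_lt hk1 one_pos, ?_⟩
  intro Λ hΛ a ha v hv _ w₀ w₁ w₂ h₀ h₁ h₂ h01 h12 h02
  have hv' : ‖fieldBelt (obs Λ a) v w₀ w₁ w₂‖ ≤ k * ‖fieldMono (obs Λ a) v w₀ w₁ w₂‖ :=
    hK Λ hΛ a ha v hv w₀ w₁ w₂ h₀ h₁ h₂ h01 h12 h02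
  exact hv'.trans (mul_le_mul_of_nonneg_right (le_max_left _ _) (norm_nonneg _))

/-- **S1 is implied by the crux (M)** (take `ε = 1/2`): the base stub costs the line nothing. -/
theorem bulkNoFold_of_interiorFlattening :
    Summit.CriticalPhenomena.SAWScalingLimit.Theses.SAWDevelopingMap.InteriorFlattening →
      ∃ k R₀ : ℝ, 0 ≤ k ∧ k < 1 ∧ RatioAtDepth R₀ k := by
  intro h
  obtain ⟨R, hR⟩ := (interiorFlattening_iff_ratioAtDepth.1 h) (1 / 2) (by norm_num)
  exact ⟨1 / 2, R, by norm_num, by norm_num, hR⟩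

/-! ### Monotonicity -/

/-- `Deep` is antitone in the radius. -/
theorem deep_anti {Λ : Finset HexVertex} {v : HexVertex} {R R' : ℝ} (h : Deep Λ v R') (hle : R ≤ R') :
    Deep Λ v R := fun w hw => h w (hw.trans hle)

/-- **`RatioAtDepth` is monotone**: a larger depth and a larger constant are weaker requirements. -/
theorem ratioAtDepth_mono {R R' η η' : ℝ} (hR : R ≤ R') (hη : η ≤ η') (h : RatioAtDepth R η) :
    RatioAtDepth R' η' := by
  intro Λ hΛ a ha v hv hdeep w₀ w₁ w₂ h₀ h₁ h₂ h01 h12 h02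
  exact (h Λ hΛ a ha v hv (deep_anti hdeep hR) w₀ w₁ w₂ h₀ h₁ h₂ h01 h12 h02).trans
    (mul_le_mul_of_nonneg_right hη (norm_nonneg _))

/-- The depth of S1 may be taken to be a natural number (round `R₀` up). -/
theorem bulkNoFold_iff_nat :
    (∃ k R₀ : ℝ, 0 ≤ k ∧ k < 1 ∧ RatioAtDepth R₀ k) ↔
      ∃ k : ℝ, ∃ n : ℕ, 0 ≤ k ∧ k < 1 ∧ RatioAtDepth n k := by
  constructor
  · rintro ⟨k, R₀, hk0, hk1, hR⟩
    exact ⟨k, ⌈R₀⌉₊, hk0, hk1, ratioAtDepth_mono (Nat.le_ceil R₀) le_rfl hR⟩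
  · rintro ⟨k, n, hk0, hk1, hR⟩
    exact ⟨k, n, hk0, hk1, hR⟩

/-- Under S1, every tolerance `η ≥ k` holds at every depth `≥ R₀`; in particular a failure of the crux
at tolerance `ε` at all depths forces `ε < k`. -/
theorem lt_of_forall_not_ratioAtDepth {k R₀ ε : ℝ} (hR : RatioAtDepth R₀ k)
    (hbad : ∀ n : ℕ, ¬ RatioAtDepth n ε) : ε < k := by
  by_contra h
  exact hbad ⌈R₀⌉₊ (ratioAtDepth_mono (Nat.le_ceil R₀) (not_lt.1 h) hR)

/-! ### Bridge to the objects of the sibling line `one-mouth-ball-reduction` -/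

/-- `RatioAtDepth R η` is the one-mouth line's crux matrix `OneMouth.DepthFlat R η` (same bodies:
`Deep`/`OneMouth.Deep`, `fieldBelt (obs Λ a)`/`OneMouth.bel Λ a`, `fieldMono (obs Λ a)`/`OneMouth.mono Λ a`;
the six frame hypotheses are bundled as `OneMouth.IsStar`). -/
theorem ratioAtDepth_iff_depthFlat {R η : ℝ} : RatioAtDepth R η ↔ OneMouth.DepthFlat R η := by
  constructor
  · intro h Λ hΛ a ha v hv hdeep w₀ w₁ w₂ hst
    obtain ⟨h₀, h₁, h₂, h01, h12, h02⟩ := hst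
    exact h Λ hΛ a ha v hv hdeep w₀ w₁ w₂ h₀ h₁ h₂ h01 h12 h02
  · intro h Λ hΛ a ha v hv hdeep w₀ w₁ w₂ h₀ h₁ h₂ h01 h12 h02
    exact h Λ hΛ a ha v hv hdeep w₀ w₁ w₂ ⟨h₀, h₁, h₂, h01, h12, h02⟩

/-- S1 implies the one-mouth line's stub S6 `DeepBoundedDistortion` (`∃ d₁ ≥ 0, ∃ K₁ ≥ 0, DepthFlat d₁ K₁`)
with `d₁ = max R₀ 0`, `K₁ = k`. -/
theorem deepBoundedDistortion_of_bulkNoFold :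
    (∃ k R₀ : ℝ, 0 ≤ k ∧ k < 1 ∧ RatioAtDepth R₀ k) →
      ∃ d₁ : ℝ, 0 ≤ d₁ ∧ ∃ K₁ : ℝ, 0 ≤ K₁ ∧ OneMouth.DepthFlat d₁ K₁ := by
  rintro ⟨k, R₀, hk0, -, hR⟩
  exact ⟨max R₀ 0, le_max_right _ _, k, hk0,
    ratioAtDepth_iff_depthFlat.1 (ratioAtDepth_mono (le_max_left _ _) le_rfl hR)⟩

/-! ### Constants: `ω = ζ²` (`OneMouth.cexp_two_pi_I_div_three`), `1 + ω + ω² = 0`, `ω³ = 1`, `‖ω‖ = 1` -/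

/-- `1 + ω + ω² = 0`, `ω³ = 1` and `‖ω‖ = 1` for the Defs module's `omega = e^{2πi/3} = ζ²`. -/
theorem omega_facts : 1 + omega + omega ^ 2 = 0 ∧ omega ^ 3 = 1 ∧ ‖omega‖ = 1 := by
  have hω : omega = triZeta ^ 2 := OneMouth.cexp_two_pi_I_div_three
  refine ⟨?_, ?_, ?_⟩
  · rw [hω]; linear_combination (triZeta ^ 2 + triZeta + 1) * triZeta_sq
  · rw [hω, ← pow_mul]; exact triZeta_pow_six
  · have h : (2 * (Real.pi : ℂ) * Complex.I / 3) = ((2 * Real.pi / 3 : ℝ) : ℂ) * Complex.I := by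
      push_cast; ring
    rw [omega, h, Complex.norm_exp_ofReal_mul_I]

/-- `1 + ω + ω² = 0`. -/
theorem one_add_omega_add_sq : 1 + omega + omega ^ 2 = 0 := omega_facts.1

/-- `1 ≠ ζ⁴`, `ζ⁴ ≠ ζ²`, `1 ≠ ζ²`: the three rotation factors of a star are distinct (`ζ⁴ = -ζ`,
`ζ² = ζ - 1`). -/
theorem rot_factors_ne :
    (1 : ℂ) ≠ triZeta ^ 4 ∧ triZeta ^ 4 ≠ triZeta ^ 2 ∧ (1 : ℂ) ≠ triZeta ^ 2 := by
  have h3 : 0 < Real.sqrt 3 := Real.sqrt_pos.2 (by norm_num)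
  have h4 : triZeta ^ 4 = -triZeta := by linear_combination (triZeta ^ 2 + triZeta) * triZeta_sq
  refine ⟨fun h => ?_, fun h => ?_, fun h => ?_⟩
  · have := congrArg Complex.re h
    rw [h4, Complex.neg_re, triZeta_re, Complex.one_re] at this
    norm_num at this
  · have := congrArg Complex.im h
    rw [h4, triZeta_sq, Complex.neg_im, Complex.sub_im, triZeta_im, Complex.one_im] at this
    linarith
  · have := congrArg Complex.re h
    rw [triZeta_sq, Complex.sub_re, triZeta_re, Complex.one_re] at this
    norm_num at this

/-- Two neighbours of `v` whose direction vectors are DIFFERENT multiples of one non-zero direction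
are distinct. -/
theorem ne_of_directions {v w₀ p q : HexVertex} {c c' : ℂ} (hcc' : c ≠ c') (h₀ : hexGraph.Adj v w₀)
    (hp : hexCenter p - hexCenter v = c * (hexCenter w₀ - hexCenter v))
    (hq : hexCenter q - hexCenter v = c' * (hexCenter w₀ - hexCenter v)) : p ≠ q := by
  rintro rfl
  have hd : hexCenter w₀ - hexCenter v ≠ 0 := sub_ne_zero.2 (hexCenter_ne_of_adj h₀).symm
  have : (c - c') * (hexCenter w₀ - hexCenter v) = 0 := by linear_combination hq - hp
  rcases mul_eq_zero.1 this with h | h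
  · exact hcc' (sub_eq_zero.1 h)
  · exact hd h

/-! ### Frame algebra of an arbitrary lattice field -/

/-- The monopole is symmetric: transposing the last two labels. -/
theorem fieldMono_swap (G : Sym2 HexVertex → ℂ) (v w₀ w₁ w₂ : HexVertex) :
    fieldMono G v w₀ w₂ w₁ = fieldMono G v w₀ w₁ w₂ := by
  unfold fieldMono; ring

/-- The monopole is symmetric: cyclic relabelling. -/
theorem fieldMono_cycle (G : Sym2 HexVertex → ℂ) (v w₀ w₁ w₂ : HexVertex) :
    fieldMono G v w₁ w₂ w₀ = fieldMono G v w₀ w₁ w₂ := by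
  unfold fieldMono; ring

/-- Cyclic relabelling multiplies the `ω`-combination by `ω²`. -/
theorem fieldBelt_cycle (G : Sym2 HexVertex → ℂ) (v w₀ w₁ w₂ : HexVertex) :
    fieldBelt G v w₁ w₂ w₀ = omega ^ 2 * fieldBelt G v w₀ w₁ w₂ := by
  unfold fieldBelt
  linear_combination (-(G s(v, w₁) + omega * G s(v, w₂))) * omega_facts.2.1

/-- Hence its norm is invariant under cyclic relabelling. -/
theorem norm_fieldBelt_cycle (G : Sym2 HexVertex → ℂ) (v w₀ w₁ w₂ : HexVertex) :
    ‖fieldBelt G v w₁ w₂ w₀‖ = ‖fieldBelt G v w₀ w₁ w₂‖ := by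
  rw [fieldBelt_cycle, norm_mul, norm_pow, omega_facts.2.2, one_pow, one_mul]

/-- **Inverse `ℤ/3` Fourier transform at a star**: `3 G{v,w₀} = M + B + B'`, where `M` is the monopole,
`B` the `ω`-combination of the frame `(w₀, w₁, w₂)` and `B'` that of the transposed frame `(w₀, w₂, w₁)`
(for the observable one of `B, B'` is the DCS mode, zero by Lemma 1, the other the Beltrami mode). -/
theorem three_mul_apply_eq (G : Sym2 HexVertex → ℂ) (v w₀ w₁ w₂ : HexVertex) :
    3 * G s(v, w₀) = fieldMono G v w₀ w₁ w₂ + fieldBelt G v w₀ w₁ w₂ + fieldBelt G v w₀ w₂ w₁ := by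
  unfold fieldMono fieldBelt
  linear_combination (-(G s(v, w₁) + G s(v, w₂))) * one_add_omega_add_sq

/-- `3 ‖G{v,w₀}‖ ≤ ‖M‖ + ‖B‖ + ‖B'‖`. -/
theorem three_mul_norm_apply_le (G : Sym2 HexVertex → ℂ) (v w₀ w₁ w₂ : HexVertex) :
    3 * ‖G s(v, w₀)‖ ≤
      ‖fieldMono G v w₀ w₁ w₂‖ + ‖fieldBelt G v w₀ w₁ w₂‖ + ‖fieldBelt G v w₀ w₂ w₁‖ := by
  have h3 : ‖(3 : ℂ)‖ = 3 := by norm_num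
  calc 3 * ‖G s(v, w₀)‖ = ‖(3 : ℂ) * G s(v, w₀)‖ := by rw [norm_mul, h3]
    _ = ‖fieldMono G v w₀ w₁ w₂ + fieldBelt G v w₀ w₁ w₂ + fieldBelt G v w₀ w₂ w₁‖ := by
        rw [three_mul_apply_eq]
    _ ≤ _ := norm_add₃_le

/-- For a field whose `ω`-combinations in BOTH frames `(w₀,w₁,w₂)`, `(w₀,w₂,w₁)` are at most `k` times
the monopole: `3 ‖G{v,w₀}‖ ≤ (1 + 2k) ‖M‖`. -/
theorem three_mul_norm_apply_le_of_both {G : Sym2 HexVertex → ℂ} {v w₀ w₁ w₂ : HexVertex} {k : ℝ}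
    (hB : ‖fieldBelt G v w₀ w₁ w₂‖ ≤ k * ‖fieldMono G v w₀ w₁ w₂‖)
    (hB' : ‖fieldBelt G v w₀ w₂ w₁‖ ≤ k * ‖fieldMono G v w₀ w₂ w₁‖) :
    3 * ‖G s(v, w₀)‖ ≤ (1 + 2 * k) * ‖fieldMono G v w₀ w₁ w₂‖ := by
  rw [fieldMono_swap] at hB'
  have h := three_mul_norm_apply_le G v w₀ w₁ w₂
  linarith

/-! ### The observable: the counter-clockwise combination vanishes (Lemma 1) -/

/-- The Defs module's `fieldBelt (obs Λ a)` is the one-mouth line's `OneMouth.bel Λ a` (same body). -/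
theorem fieldBelt_obs_eq_bel (Λ : Finset HexVertex) (a : Sym2 HexVertex) (v w₀ w₁ w₂ : HexVertex) :
    fieldBelt (obs Λ a) v w₀ w₁ w₂ = OneMouth.bel Λ a v w₀ w₁ w₂ := rfl

/-- The Defs module's `fieldMono (obs Λ a)` is the one-mouth line's `OneMouth.mono Λ a` (same body). -/
theorem fieldMono_obs_eq_mono (Λ : Finset HexVertex) (a : Sym2 HexVertex) (v w₀ w₁ w₂ : HexVertex) :
    fieldMono (obs Λ a) v w₀ w₁ w₂ = OneMouth.mono Λ a v w₀ w₁ w₂ := rfl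

/-- **Lemma 1 in mode form, over the Defs objects.** For a simply connected `Λ`, a boundary root `a`,
`v ∈ Λ` and a COUNTER-CLOCKWISE frame (`c w₁ - c v = ζ² (c w₀ - c v)`, `c w₂ - c v = ζ⁴ (c w₀ - c v)`):
`F{v,w₀} + ω F{v,w₁} + ω² F{v,w₂} = 0`. -/
theorem fieldBelt_obs_eq_zero_of_ccw {Λ : Finset HexVertex} (hΛ : hexDomainSimplyConnected Λ)
    {a : Sym2 HexVertex} (ha : a ∈ hexDomainBoundary Λ) {v : HexVertex} (hv : v ∈ Λ)
    {w₀ w₁ w₂ : HexVertex} (h₀ : hexGraph.Adj v w₀) (h₁ : hexGraph.Adj v w₁) (h₂ : hexGraph.Adj v w₂)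
    (hd₁ : hexCenter w₁ - hexCenter v = triZeta ^ 2 * (hexCenter w₀ - hexCenter v))
    (hd₂ : hexCenter w₂ - hexCenter v = triZeta ^ 4 * (hexCenter w₀ - hexCenter v)) :
    fieldBelt (obs Λ a) v w₀ w₁ w₂ = 0 := by
  obtain ⟨hae, u, c₀, rfl, hc₀, hu⟩ := ha
  have huc : hexGraph.Adj u c₀ := by simpa using hae
  obtain ⟨h14, h42, h12⟩ := rot_factors_ne
  have h01 : w₀ ≠ w₁ :=
    ne_of_directions h12 h₀ (by rw [one_mul]) hd₁
  have h12' : w₁ ≠ w₂ := ne_of_directions h42.symm h₀ hd₁ hd₂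
  have h02 : w₀ ≠ w₂ :=
    ne_of_directions h14 h₀ (by rw [one_mul]) hd₂
  rw [fieldBelt_obs_eq_bel]
  exact OneMouth.bel_eq_zero_of_ccw hΛ hu hc₀ huc hv ⟨h₀, h₁, h₂, h01, h12', h02⟩ hd₁ hd₂

/-- **It suffices to check clockwise frames.** For `η ≥ 0`, `RatioAtDepth R η` is equivalent to the same
inequality restricted to CLOCKWISE frames (`c w₁ - c v = ζ⁴ (c w₀ - c v)`, `c w₂ - c v = ζ² (c w₀ - c v)`):
every labelled star is clockwise or counter-clockwise (`hexStar_directions`), and the counter-clockwise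
`ω`-combination of the observable is `0` (Lemma 1). -/
theorem ratioAtDepth_iff_cw {R η : ℝ} (hη : 0 ≤ η) :
    RatioAtDepth R η ↔
      ∀ (Λ : Finset HexVertex), hexDomainSimplyConnected Λ → ∀ a ∈ hexDomainBoundary Λ, ∀ v ∈ Λ,
        Deep Λ v R → ∀ w₀ w₁ w₂ : HexVertex,
          hexGraph.Adj v w₀ → hexGraph.Adj v w₁ → hexGraph.Adj v w₂ →
          hexCenter w₁ - hexCenter v = triZeta ^ 4 * (hexCenter w₀ - hexCenter v) →
          hexCenter w₂ - hexCenter v = triZeta ^ 2 * (hexCenter w₀ - hexCenter v) →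
            ‖fieldBelt (obs Λ a) v w₀ w₁ w₂‖ ≤ η * ‖fieldMono (obs Λ a) v w₀ w₁ w₂‖ := by
  obtain ⟨h14, h42, h12⟩ := rot_factors_ne
  constructor
  · intro H Λ hΛ a ha v hv hdeep w₀ w₁ w₂ h₀ h₁ h₂ hd₁ hd₂
    exact H Λ hΛ a ha v hv hdeep w₀ w₁ w₂ h₀ h₁ h₂
      (ne_of_directions h14 h₀ (by rw [one_mul]) hd₁) (ne_of_directions h42 h₀ hd₁ hd₂)
      (ne_of_directions h12 h₀ (by rw [one_mul]) hd₂)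
  · intro H Λ hΛ a ha v hv hdeep w₀ w₁ w₂ h₀ h₁ h₂ h01 h12' h02
    rcases hexStar_directions h₀ h₁ h₂ h01 h12' h02 with ⟨hd₁, hd₂⟩ | ⟨hd₁, hd₂⟩
    · rw [fieldBelt_obs_eq_zero_of_ccw hΛ ha hv h₀ h₁ h₂ hd₁ hd₂, norm_zero]
      exact mul_nonneg hη (norm_nonneg _)
    · exact H Λ hΛ a ha v hv hdeep w₀ w₁ w₂ h₀ h₁ h₂ hd₁ hd₂

/-- For the observable of a simply connected domain with a boundary root, ONE of the two
`ω`-combinations `B = B(w₀,w₁,w₂)`, `B' = B(w₀,w₂,w₁)` at any labelled star vanishes. -/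
theorem fieldBelt_obs_eq_zero_or {Λ : Finset HexVertex} (hΛ : hexDomainSimplyConnected Λ)
    {a : Sym2 HexVertex} (ha : a ∈ hexDomainBoundary Λ) {v : HexVertex} (hv : v ∈ Λ)
    {w₀ w₁ w₂ : HexVertex} (h₀ : hexGraph.Adj v w₀) (h₁ : hexGraph.Adj v w₁) (h₂ : hexGraph.Adj v w₂)
    (h01 : w₀ ≠ w₁) (h12 : w₁ ≠ w₂) (h02 : w₀ ≠ w₂) :
    fieldBelt (obs Λ a) v w₀ w₁ w₂ = 0 ∨ fieldBelt (obs Λ a) v w₀ w₂ w₁ = 0 := by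
  rcases hexStar_directions h₀ h₁ h₂ h01 h12 h02 with ⟨hd₁, hd₂⟩ | ⟨hd₁, hd₂⟩
  · exact Or.inl (fieldBelt_obs_eq_zero_of_ccw hΛ ha hv h₀ h₁ h₂ hd₁ hd₂)
  · exact Or.inr (fieldBelt_obs_eq_zero_of_ccw hΛ ha hv h₀ h₂ h₁ hd₂ hd₁)

/-! ### Consequences of `RatioAtDepth R k` at a deep vertex: edge values against the monopole -/

/-- **Each edge value is bounded by the monopole** (no Lemma 1, any `k`): under `RatioAtDepth R k`, at an
`R`-deep vertex `v` of a simply connected domain with a boundary root, `3 ‖F{v,w₀}‖ ≤ (1 + 2k) ‖M‖`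
(apply the hypothesis to both frames `(w₀,w₁,w₂)` and `(w₀,w₂,w₁)` and use `3F₀ = M + B + B'`). -/
theorem three_mul_norm_obs_le {R k : ℝ} (hR : RatioAtDepth R k) {Λ : Finset HexVertex}
    (hΛ : hexDomainSimplyConnected Λ) {a : Sym2 HexVertex} (ha : a ∈ hexDomainBoundary Λ)
    {v : HexVertex} (hv : v ∈ Λ) (hdeep : Deep Λ v R) {w₀ w₁ w₂ : HexVertex}
    (h₀ : hexGraph.Adj v w₀) (h₁ : hexGraph.Adj v w₁) (h₂ : hexGraph.Adj v w₂)
    (h01 : w₀ ≠ w₁) (h12 : w₁ ≠ w₂) (h02 : w₀ ≠ w₂) :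
    3 * ‖obs Λ a s(v, w₀)‖ ≤ (1 + 2 * k) * ‖fieldMono (obs Λ a) v w₀ w₁ w₂‖ :=
  three_mul_norm_apply_le_of_both (hR Λ hΛ a ha v hv hdeep w₀ w₁ w₂ h₀ h₁ h₂ h01 h12 h02)
    (hR Λ hΛ a ha v hv hdeep w₀ w₂ w₁ h₀ h₂ h₁ h02 h12.symm h01)

/-- **Sharper, with Lemma 1**: under `RatioAtDepth R k`, at an `R`-deep vertex,
`3 ‖F{v,w₀}‖ ≤ (1 + k) ‖M‖` (one of `B, B'` is the DCS mode, zero). -/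
theorem three_mul_norm_obs_le_sc {R k : ℝ} (hR : RatioAtDepth R k) {Λ : Finset HexVertex}
    (hΛ : hexDomainSimplyConnected Λ) {a : Sym2 HexVertex} (ha : a ∈ hexDomainBoundary Λ)
    {v : HexVertex} (hv : v ∈ Λ) (hdeep : Deep Λ v R) {w₀ w₁ w₂ : HexVertex}
    (h₀ : hexGraph.Adj v w₀) (h₁ : hexGraph.Adj v w₁) (h₂ : hexGraph.Adj v w₂)
    (h01 : w₀ ≠ w₁) (h12 : w₁ ≠ w₂) (h02 : w₀ ≠ w₂) :
    3 * ‖obs Λ a s(v, w₀)‖ ≤ (1 + k) * ‖fieldMono (obs Λ a) v w₀ w₁ w₂‖ := by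
  have h := three_mul_norm_apply_le (obs Λ a) v w₀ w₁ w₂
  have hB := hR Λ hΛ a ha v hv hdeep w₀ w₁ w₂ h₀ h₁ h₂ h01 h12 h02
  have hB' := hR Λ hΛ a ha v hv hdeep w₀ w₂ w₁ h₀ h₂ h₁ h02 h12.symm h01
  rw [fieldMono_swap] at hB'
  rcases fieldBelt_obs_eq_zero_or hΛ ha hv h₀ h₁ h₂ h01 h12 h02 with hz | hz
  · rw [hz, norm_zero] at h
    linarith
  · rw [hz, norm_zero] at h
    linarith

/-- **Non-degeneracy of the normalisation.** Under `RatioAtDepth R k` (any `k`), at an `R`-deep vertex of a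
simply connected domain with a boundary root, if the monopole `F{v,w₀} + F{v,w₁} + F{v,w₂}` vanishes then
all three edge values vanish. -/
theorem obs_star_eq_zero_of_fieldMono_eq_zero {R k : ℝ} (hR : RatioAtDepth R k) {Λ : Finset HexVertex}
    (hΛ : hexDomainSimplyConnected Λ) {a : Sym2 HexVertex} (ha : a ∈ hexDomainBoundary Λ)
    {v : HexVertex} (hv : v ∈ Λ) (hdeep : Deep Λ v R) {w₀ w₁ w₂ : HexVertex}
    (h₀ : hexGraph.Adj v w₀) (h₁ : hexGraph.Adj v w₁) (h₂ : hexGraph.Adj v w₂)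
    (h01 : w₀ ≠ w₁) (h12 : w₁ ≠ w₂) (h02 : w₀ ≠ w₂) (hM : fieldMono (obs Λ a) v w₀ w₁ w₂ = 0) :
    obs Λ a s(v, w₀) = 0 ∧ obs Λ a s(v, w₁) = 0 ∧ obs Λ a s(v, w₂) = 0 := by
  have hM1 : fieldMono (obs Λ a) v w₁ w₀ w₂ = 0 :=
    (show fieldMono (obs Λ a) v w₁ w₀ w₂ = fieldMono (obs Λ a) v w₀ w₁ w₂ by unfold fieldMono; ring).trans hM
  have hM2 : fieldMono (obs Λ a) v w₂ w₀ w₁ = 0 :=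
    (show fieldMono (obs Λ a) v w₂ w₀ w₁ = fieldMono (obs Λ a) v w₀ w₁ w₂ by unfold fieldMono; ring).trans hM
  have e0 := three_mul_norm_obs_le hR hΛ ha hv hdeep h₀ h₁ h₂ h01 h12 h02
  have e1 := three_mul_norm_obs_le hR hΛ ha hv hdeep h₁ h₀ h₂ h01.symm h02 h12
  have e2 := three_mul_norm_obs_le hR hΛ ha hv hdeep h₂ h₀ h₁ h02.symm h01 h12.symm
  rw [hM, norm_zero, mul_zero] at e0
  rw [hM1, norm_zero, mul_zero] at e1
  rw [hM2, norm_zero, mul_zero] at e2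
  refine ⟨?_, ?_, ?_⟩
  · exact norm_eq_zero.1 (le_antisymm (by linarith [norm_nonneg (obs Λ a s(v, w₀))]) (norm_nonneg _))
  · exact norm_eq_zero.1 (le_antisymm (by linarith [norm_nonneg (obs Λ a s(v, w₁))]) (norm_nonneg _))
  · exact norm_eq_zero.1 (le_antisymm (by linarith [norm_nonneg (obs Λ a s(v, w₂))]) (norm_nonneg _))

/-- **Contrapositive**: under `RatioAtDepth R k`, at an `R`-deep vertex one non-zero edge value forces a
non-zero monopole (so the `M(O)`-normalisation of stub S2 is legitimate at bad vertices). -/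
theorem fieldMono_ne_zero_of_obs_ne_zero {R k : ℝ} (hR : RatioAtDepth R k) {Λ : Finset HexVertex}
    (hΛ : hexDomainSimplyConnected Λ) {a : Sym2 HexVertex} (ha : a ∈ hexDomainBoundary Λ)
    {v : HexVertex} (hv : v ∈ Λ) (hdeep : Deep Λ v R) {w₀ w₁ w₂ : HexVertex}
    (h₀ : hexGraph.Adj v w₀) (h₁ : hexGraph.Adj v w₁) (h₂ : hexGraph.Adj v w₂)
    (h01 : w₀ ≠ w₁) (h12 : w₁ ≠ w₂) (h02 : w₀ ≠ w₂)
    (hne : obs Λ a s(v, w₀) ≠ 0 ∨ obs Λ a s(v, w₁) ≠ 0 ∨ obs Λ a s(v, w₂) ≠ 0) :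
    fieldMono (obs Λ a) v w₀ w₁ w₂ ≠ 0 := by
  intro hM
  obtain ⟨e0, e1, e2⟩ := obs_star_eq_zero_of_fieldMono_eq_zero hR hΛ ha hv hdeep h₀ h₁ h₂ h01 h12 h02 hM
  rcases hne with h | h | h
  · exact h e0
  · exact h e1
  · exact h e2

/-- **A bad vertex has a non-zero monopole.** Under `RatioAtDepth R k`, at an `R`-deep vertex a STRICT
failure `η ‖M‖ < ‖B‖` of some tolerance in some frame forces `M ≠ 0` (if `M = 0` then all edge values,
hence `B`, vanish). -/
theorem fieldMono_ne_zero_of_bad {R k η : ℝ} (hR : RatioAtDepth R k) {Λ : Finset HexVertex}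
    (hΛ : hexDomainSimplyConnected Λ) {a : Sym2 HexVertex} (ha : a ∈ hexDomainBoundary Λ)
    {v : HexVertex} (hv : v ∈ Λ) (hdeep : Deep Λ v R) {w₀ w₁ w₂ : HexVertex}
    (h₀ : hexGraph.Adj v w₀) (h₁ : hexGraph.Adj v w₁) (h₂ : hexGraph.Adj v w₂)
    (h01 : w₀ ≠ w₁) (h12 : w₁ ≠ w₂) (h02 : w₀ ≠ w₂)
    (hbad : η * ‖fieldMono (obs Λ a) v w₀ w₁ w₂‖ < ‖fieldBelt (obs Λ a) v w₀ w₁ w₂‖) :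
    fieldMono (obs Λ a) v w₀ w₁ w₂ ≠ 0 := by
  intro hM
  obtain ⟨e0, e1, e2⟩ := obs_star_eq_zero_of_fieldMono_eq_zero hR hΛ ha hv hdeep h₀ h₁ h₂ h01 h12 h02 hM
  have hB : fieldBelt (obs Λ a) v w₀ w₁ w₂ = 0 := by
    unfold fieldBelt; rw [e0, e1, e2]; ring
  rw [hM, hB, norm_zero, mul_zero] at hbad
  exact lt_irrefl _ hbad

end BulkNoFold

end Summit.CriticalPhenomena.SAWScalingLimit.Theorems.InteriorFlattening.Liouville

end
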